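import Summits.BirchSwinnertonDyer.BirchSwinnertonDyer.Theorems.PrintCFramBottomClassIndexLawFiveLeBorelNonSplitCriterion
import Literature.NumberTheory.EllipticCurves.CyclicIsogenyCharacterFrobeniusProofs
import Literature.NumberTheory.EllipticCurves.RationalIsogenyFrobeniusCriterion
import Literature.NumberTheory.EllipticCurves.PointCountEulerCriterion
import HarnessLib

/-!
# Route `PrintCFram`, crux C2 `BottomClassIndexLawFiveLe` (stmt-BirchSwinnertonDyer-20372), line
# `eisenstein-resource-bdp-line` (S2, input hCe / (NS)): a CM FROBENIUS IS NON-SCALAR ON `E[p]` — for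
# every CM curve `W/ℚ` with `p ≥ 5` ramified in the CM field there is `σ ∈ Γ_ℚ` fixing `√−p` whose
# action on `W[p]` is not a homothety; so the rational line `W[𝔭]` is the unique `Γ_{ℚ(√−p)}`-stable
# line and `0 → W[𝔭] → W[p] → W[p]/W[𝔭] → 0` does not split over any field fixing `√−p`
# (cell `bsd-print-cfram`, seat `bsd-line-cfram-p1-w2` g5; helper `--supports` 20372; 0 facts, 0 defs)

HONEST FRAMING. Nothing about BSD is proved here. File 7b of the width seat. §1 `exists_frobenius_manin`
— Manin's relation `σ₀² − a_ℓ σ₀ + ℓ = 0` on the `p`-primary torsion of a globally minimal `W/ℚ` for an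
arithmetic Frobenius `σ₀` at a good prime `ℓ ≠ p` (Steps 0–2 of the tree's
`Mazur1978.cyclicCharacter_sq_sub_frobeniusTrace_mul_add_eq_zero`, recorded for all of `E[p^∞]`).
§2 **`exists_nonscalar_of_frobenius_cert`** — for `W` globally minimal on the leaf and a good prime
`ℓ ≠ 2, p` with `−p` a square mod `ℓ` and `v_p(a_ℓ² − 4ℓ) = 1`: an arithmetic Frobenius `σ` at `ℓ` fixes
`√−p` and is NOT a homothety on `W[p]` (file 7a `not_scalar_of_disc`). §3 `exists_scalar_of_iso`,
`not_scalar_of_iso_pair` — (non-)homotheties transport along `ℚ̄`-isomorphisms with a sign rule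
(`DeuringLadic.exists_iso_of_j_eq`). The certificates for the seven leaf models and the class-wide
statement are the sequels (files 7c, 7d). THEOREMS ONLY; no definition, no named
fact, no `sorry`. BSD is not proved by any of this.
References: [Mazur1978] Prop. 6.3 (1); [SilvermanAEC2009] V.2.3.1, VII.3.1; [Cox2013] Thm. 14.16.
-/

set_option autoImplicit false
-- `…BirchSwinnertonDyer.BirchSwinnertonDyer.Theorems…` is the problem's mandated namespace (D-0017).
set_option linter.dupNamespace false

noncomputable section

open scoped Classical

namespace Summit.BirchSwinnertonDyer.BirchSwinnertonDyer.Theorems.PrintCFram.BorelHomothety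

open WeierstrassCurve Field NumberField IsDedekindDomain IsDedekindDomain.HeightOneSpectrum
  Literature.NumberTheory.EllipticCurves Literature.NumberTheory.GaloisRepresentations
  Literature.NumberTheory.EllipticCurves.Rank1Residual

/-! ## §1 Manin's relation for an arithmetic Frobenius on `E[p^∞]` -/

section Manin

/-- **Manin's relation on the `p`-primary torsion.** For `W/ℚ` globally minimal, primes `ℓ ≠ p`
with `ℓ` of good reduction, and the place `v` of `ℓ`: there are a prime `𝔓 ∣ v` of `\bar ℤ` and an
arithmetic Frobenius `σ₀ ∈ Γ_ℚ` at `𝔓` with `σ₀(σ₀ P) − a_ℓ σ₀ P + ℓ P = 0` for every `P ∈ E[p^∞]`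
(reduction map on `p`-primary torsion at the good place, Silverman VII.3.1(b); Manin's relation
`φ² − aφ + ℓ = 0` on `Ẽ(\bar 𝔽_ℓ)`, V.2.3.1(b)). Steps 0–2 of the tree's
`Mazur1978.cyclicCharacter_sq_sub_frobeniusTrace_mul_add_eq_zero`, verbatim.
[cite: SilvermanAEC2009, Thm. V.2.3.1 and Prop. VII.3.1(b)] [cite: Mazur1978, §6 Prop. 6.3 (1)] -/
theorem exists_frobenius_manin (W : WeierstrassCurve ℚ) [W.IsElliptic] [W.IsGloballyMinimal]
    (p ℓ : ℕ) [Fact p.Prime] [Fact ℓ.Prime] (hℓp : ℓ ≠ p) (hgoodℓ : W.HasGoodReductionAtPrime ℓ)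
    {v : HeightOneSpectrum (𝓞 ℚ)} (hv : (ℓ : 𝓞 ℚ) ∈ v.asIdeal) :
    ∃ (𝔓 : Ideal (absIntegers (𝓞 ℚ) ℚ)) (_ : 𝔓 ∈ v.primesAbove) (σ₀ : absoluteGaloisGroup ℚ),
      IsArithFrobAt (𝓞 ℚ) σ₀ 𝔓 ∧
      ∀ P : W.geomPoints, P ∈ geomPrimaryTorsion W p →
        σ₀ • (σ₀ • P) - W.frobeniusTrace ℓ • (σ₀ • P) + (ℓ : ℤ) • P = 0 := by
  have hp : p.Prime := Fact.out
  have hℓ : ℓ.Prime := Fact.out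
  -- Step 0: from the rational prime `ℓ` to the place `v`
  have hvℓ : (Rat.HeightOneSpectrum.primesEquiv v : ℕ) = ℓ := primesEquiv_eq_of_natCast_mem hℓ hv
  have hgood : W.HasGoodReductionAt v :=
    (hasGoodReductionAtPrime_primesEquiv_iff_holds W v ℓ hvℓ).mp hgoodℓ
  have hpv : (p : 𝓞 ℚ) ∉ v.asIdeal := fun h ↦
    hℓp (hvℓ.symm.trans (primesEquiv_eq_of_natCast_mem hp h))
  -- the reduction `Ẽ_v / k_v`
  set kv := IsLocalRing.ResidueField (v.adicCompletionIntegers ℚ) with hkv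
  letI : Fintype kv := Fintype.ofFinite kv
  set Wt : WeierstrassCurve kv := W.reductionAt v with hWt
  haveI : Wt.IsElliptic := isElliptic_reductionAt hgood
  have hcardk : Fintype.card kv = ℓ := by
    rw [← Nat.card_eq_fintype_card, natCard_residueField_adicCompletionIntegers v, hvℓ]
  have hcardWt : Nat.card Wt.toAffine.Point = W.reductionPointCount ℓ := by
    rw [← hvℓ]
    exact natCard_point_reduction_minimal_baseChange v W
  have htr : HasseManin.tr Wt = W.frobeniusTrace ℓ := by
    rw [HasseManin.tr, hcardk, hcardWt, frobeniusTrace]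
  -- Step 1: the reduction map on `p`-primary torsion, for a local Frobenius
  obtain ⟨𝔐, h𝔐⟩ := v.localPrimesAbove_nonempty
  let ι : AlgebraicClosure ℚ →ₐ[ℚ] AlgebraicClosure (v.adicCompletion ℚ) :=
    closureEmb (K := ℚ) (v.adicCompletion ℚ)
  obtain ⟨σL, hσL⟩ := v.exists_isArithFrobAt_localAbsIntegers h𝔐
  obtain ⟨φk, hφk⟩ := exists_frobenius_absoluteGaloisGroup kv
  obtain ⟨f, hf, hfσ⟩ := exists_reduceTorsionHom hpv hgood h𝔐 ι hσL hφk
  set σ₀ : absoluteGaloisGroup ℚ := resGalOfEmb ι σL with hσ₀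
  have hσ₀F : IsArithFrobAt (𝓞 ℚ) σ₀ (v.primeBelow ι 𝔐) := isArithFrobAt_resGalOfEmb h𝔐 ι hσL
  refine ⟨v.primeBelow ι 𝔐, primeBelow_mem_primesAbove h𝔐, σ₀, hσ₀F, fun P hP => ?_⟩
  -- Step 2: Manin's relation at `f P'`, pulled back along `f`
  set P' : geomPrimaryTorsion W p := ⟨P, hP⟩ with hP'
  have hmanin := Wt.frobenius_sq_sub_trace_smul_add_card_smul hφk (f P')
  rw [htr, hcardk, ← hfσ, ← hfσ, ← map_zsmul, ← map_zsmul, ← map_sub, ← map_add,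
    ← f.map_zero] at hmanin
  have hrel : σ₀ • (σ₀ • P') - W.frobeniusTrace ℓ • (σ₀ • P') + (ℓ : ℤ) • P' = 0 := hf hmanin
  have h := congrArg Subtype.val hrel
  simpa using h

end Manin

/-! ## §2 A Frobenius certificate gives a non-scalar element commuting with `√−p` -/

section Cert

variable (W : WeierstrassCurve ℚ) [W.IsElliptic] [W.IsGloballyMinimal] (p ℓ : ℕ)
  [hp : Fact p.Prime] [hℓ : Fact ℓ.Prime]

/-- **Non-scalar Frobenius from a certificate.** For `W/ℚ` globally minimal on the leaf (`W.HasCM`,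
`CMRamified W p`, `5 ≤ p`), a good prime `ℓ ≠ 2, p` with `−p` a square mod `ℓ` (so `ℓ` splits in
`K = ℚ(√−p)`) and `v_p(a_ℓ² − 4ℓ) = 1`: there are `s = √−p` and an arithmetic Frobenius `σ ∈ Γ_ℚ` at a
prime over `ℓ` with `σ s = s` whose action on `W[p]` is NOT an integer homothety (file 7a
`not_scalar_of_disc`, Manin's relation of §1, `DeuringLadic.smul_eq_self_of_isArithFrobAt`).
[cite: Mazur1978, §6 Prop. 6.3 (1)] [cite: Cox2013, Thm. 14.16] -/
theorem exists_nonscalar_of_frobenius_cert (hℓp : ℓ ≠ p) (hℓ2 : ℓ ≠ 2)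
    (hgood : W.HasGoodReductionAtPrime ℓ) (hsq : IsSquare (((-(p : ℤ) : ℤ)) : ZMod ℓ))
    (hdisc : (p : ℤ) ∣ W.frobeniusTrace ℓ ^ 2 - 4 * ℓ)
    (hdisc2 : ¬ (p : ℤ) ^ 2 ∣ W.frobeniusTrace ℓ ^ 2 - 4 * ℓ)
    (hCM : W.HasCM) (h5 : 5 ≤ p) (hram : CMRamified W p) :
    ∃ (s : AlgebraicClosure ℚ) (σ : absoluteGaloisGroup ℚ),
      s ^ 2 = ((-(p : ℤ) : ℤ) : AlgebraicClosure ℚ) ∧ σ • s = s ∧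
      ¬ ∃ t : ℤ, ∀ P ∈ W.geomTorsion (p : ℤ), σ • P = t • P := by
  have hpr : p.Prime := hp.out
  have hℓr : ℓ.Prime := hℓ.out
  obtain ⟨v, hv, -⟩ := BorelTorsion.exists_place_mem_and_primesAbove (p := ℓ)
  have hvℓ : (Rat.HeightOneSpectrum.primesEquiv v : ℕ) = ℓ := primesEquiv_eq_of_natCast_mem hℓr hv
  obtain ⟨𝔓, h𝔓, σ₀, hσ₀F, hmanin⟩ := exists_frobenius_manin W p ℓ hℓp hgood hv
  obtain ⟨s, μ, m, hs, hm, hμμ, hcomm, -, hne, -⟩ := exists_generator_pair_of_cmRamified W p hCM h5 hram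
  -- `σ₀` fixes `s = √−p` (`ℓ` splits in `ℚ(√−p)`)
  have hpd : ¬ (ℓ : ℤ) ∣ -(p : ℤ) := by
    rw [dvd_neg, Int.natCast_dvd_natCast]
    intro h
    exact hℓp ((Nat.prime_dvd_prime_iff_eq hℓr hpr).mp h)
  have hfix : σ₀ • s = s :=
    DeuringLadic.smul_eq_self_of_isArithFrobAt hℓr hℓ2 hpd hsq hs hvℓ h𝔓 hσ₀F
  refine ⟨s, σ₀, hs, hfix, ?_⟩
  -- `σ₀` as an additive endomorphism commuting with `μ`, with Manin's relation on `W[p²]`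
  set φ : W.geomPoints →+ W.geomPoints := DistribSMul.toAddMonoidHom W.geomPoints σ₀ with hφ_def
  have hφ : ∀ P, φ P = σ₀ • P := fun P => rfl
  have hφμ : ∀ P, φ (μ P) = μ (φ P) := fun P => by rw [hφ, hφ, hcomm σ₀ hfix P]
  have hφT : ∀ P ∈ W.geomTorsion ((p ^ 2 : ℕ) : ℤ), φ P ∈ W.geomTorsion ((p ^ 2 : ℕ) : ℤ) :=
    fun P hP => Literature.NumberTheory.EllipticCurves.smul_mem_torsionBy σ₀ hP
  have hCH : ∀ P ∈ W.geomTorsion ((p ^ 2 : ℕ) : ℤ),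
      φ (φ P) - W.frobeniusTrace ℓ • φ P + (ℓ : ℤ) • P = 0 := by
    intro P hP
    rw [hφ, hφ]
    exact hmanin P ((AddCommGroup.mem_primaryComponent).mpr ⟨2, AddSubgroup.torsionBy.nsmul_iff.mp hP⟩)
  have h := not_scalar_of_disc (μ : W.geomPoints →+ W.geomPoints) hμμ hm hpr
    (W.natCard_geomTorsion_prime_eq_sq hpr) (natCard_geomTorsion_pow W p 2) hne φ hφμ hφT hCH
    hdisc hdisc2
  simpa [hφ] using h

end Cert

/-! ## §3 Transport along `ℚ̄`-isomorphisms with a sign rule -/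

section Transport

variable {W E : WeierstrassCurve ℚ} (p : ℕ)

/-- **Homotheties transport along a `ℚ̄`-isomorphism with a sign rule.** If `ι : W(ℚ̄) ≃ E(ℚ̄)`
commutes or anti-commutes with each `g ∈ Γ_ℚ` (`DeuringLadic.exists_iso_of_j_eq`) and `σ` acts on
`W[p]` as an integer `t`, then `σ` acts on `E[p]` as `t` or `−t`. [folklore] -/
theorem exists_scalar_of_iso (ι : W.geomPoints ≃+ E.geomPoints)
    (hι : ∀ g : absoluteGaloisGroup ℚ, (∀ P, ι (g • P) = g • ι P) ∨ (∀ P, ι (g • P) = -(g • ι P)))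
    {σ : absoluteGaloisGroup ℚ} (hσ : ∃ t : ℤ, ∀ P ∈ W.geomTorsion (p : ℤ), σ • P = t • P) :
    ∃ t : ℤ, ∀ Q ∈ E.geomTorsion (p : ℤ), σ • Q = t • Q := by
  obtain ⟨t, ht⟩ := hσ
  have hmem : ∀ Q ∈ E.geomTorsion (p : ℤ), ι.symm Q ∈ W.geomTorsion (p : ℤ) := fun Q hQ => by
    rw [AddSubgroup.torsionBy.nsmul_iff, ← map_nsmul, AddSubgroup.torsionBy.nsmul_iff.mp hQ, map_zero]
  rcases hι σ with hσι | hσι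
  · refine ⟨t, fun Q hQ => ?_⟩
    have h := hσι (ι.symm Q)
    rw [AddEquiv.apply_symm_apply, ht _ (hmem Q hQ), map_zsmul, AddEquiv.apply_symm_apply] at h
    exact h.symm
  · refine ⟨-t, fun Q hQ => ?_⟩
    have h := hσι (ι.symm Q)
    rw [AddEquiv.apply_symm_apply, ht _ (hmem Q hQ), map_zsmul, AddEquiv.apply_symm_apply] at h
    rw [neg_smul, h, neg_neg]

/-- **Non-homotheties transport**: with sign-rule isomorphisms `ι : W ≃ E` and `ι₀ : W₀ ≃ E` to a
common `E`, if `σ` is not a homothety on `W₀[p]` then it is not one on `W[p]`. [folklore] -/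
theorem not_scalar_of_iso_pair {W₀ : WeierstrassCurve ℚ} (ι : W.geomPoints ≃+ E.geomPoints)
    (hι : ∀ g : absoluteGaloisGroup ℚ, (∀ P, ι (g • P) = g • ι P) ∨ (∀ P, ι (g • P) = -(g • ι P)))
    (ι₀ : W₀.geomPoints ≃+ E.geomPoints)
    (hι₀ : ∀ g : absoluteGaloisGroup ℚ, (∀ P, ι₀ (g • P) = g • ι₀ P) ∨ (∀ P, ι₀ (g • P) = -(g • ι₀ P)))
    {σ : absoluteGaloisGroup ℚ} (hσ : ¬ ∃ t : ℤ, ∀ P ∈ W₀.geomTorsion (p : ℤ), σ • P = t • P) :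
    ¬ ∃ t : ℤ, ∀ P ∈ W.geomTorsion (p : ℤ), σ • P = t • P := by
  intro h
  apply hσ
  have hE := exists_scalar_of_iso p ι hι h
  have hι₀' : ∀ g : absoluteGaloisGroup ℚ, (∀ Q, ι₀.symm (g • Q) = g • ι₀.symm Q) ∨
      (∀ Q, ι₀.symm (g • Q) = -(g • ι₀.symm Q)) := by
    intro g
    rcases hι₀ g with h0 | h0
    · exact Or.inl (DeuringLadic.symm_smul_of ι₀ h0)
    · exact Or.inr (DeuringLadic.symm_smul_neg_of ι₀ h0)
  exact exists_scalar_of_iso p ι₀.symm hι₀' hE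

end Transport

end Summit.BirchSwinnertonDyer.BirchSwinnertonDyer.Theorems.PrintCFram.BorelHomothety

end
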